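import Summits.AtomisticToContinuum.BoseEinsteinCondensation.Theses.BECHeatBathGap
import Summits.AtomisticToContinuum.BoseEinsteinCondensation.Theorems.BECHeatBathGapSquareSummableInfluenceStubInfluenceLipschitzState
import Summits.AtomisticToContinuum.BoseEinsteinCondensation.Theorems.BECHeatBathGapSquareSummableInfluenceStubGroundStateApprox
import Summits.AtomisticToContinuum.BoseEinsteinCondensation.Theorems.BECHeatBathGapSquareSummableInfluenceExistence
import Summits.AtomisticToContinuum.BoseEinsteinCondensation.Theorems.BECCutLineWeakDisorderGroundStateRigidityStubCompactness
import Literature.MathematicalPhysics.QuantumManyBody.GroundState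
import HarnessLib

/-!
# Route `BECHeatBathGap`, crux `SquareSummableInfluence` (stmt-AtomisticToContinuum-14368), line `registered`:
# the crux is EQUIVALENT to its ground-state form (the `(N+1)`-body slack is pure frame)

Supports (does not close) stmt-AtomisticToContinuum-14368 (lead c2). The crux A2 asks, at low density and
eventually in `N`, for a slack `δ₂ > 0` such that EVERY `δ₂`-near-minimiser `Θ` of the `N`-body Dirichlet
energy in the box of side `L' = ((N+1)/ρ)^{1/3}` is predicted particle-by-particle (bounded measurable
predictors `g_i` blind to `x_i`), at EVERY slack `δ > 0`, by SOME `δ`-near-minimiser `Ψ` of the `(N+1)`-body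
energy with total squared influence `∑_i ∫ |Ψ − g_i Θ(tail)|² ≤ ε`. This file proves, for every admissible
`v` and with no nondegeneracy hypothesis anywhere, that the quantifier layer `∀ δ > 0, ∃ Ψ (δ-near-minimiser)`
can be replaced by `∃ Ψ₀, IsGroundState v L' Ψ₀` — the GROUND-STATE FORM of the crux — in both directions:

* `nearMinimiser_near_groundState` (frame, new): at every `(N, L, v)` with `E₀ < ⊤`, for every `η > 0` some
  `δ > 0` puts EVERY `δ`-near-minimiser within `η` in `L²` of SOME closed-form ground state (compactness of
  bounded-energy sequences, `stub_compactness`, and `IsGroundState.of_tendstoL2`; by contradiction; no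
  uniqueness, no phase).
* `squareSummableInfluence_of_groundStateForm`: ground-state form ⇒ crux (a ground state has near-minimisers
  of every slack `L²`-close to it, `stub_groundStateApprox`; the influence sum is `L²`-Lipschitz in the
  `(N+1)`-body state, `stub_influenceLipschitzState`).
* `groundStateForm_of_squareSummableInfluence`: crux ⇒ ground-state form (`E₀(N+1, L') < ⊤` eventually at
  low density, `eventually_exists_groundStates_succBox`; the lemma above; the same Lipschitz estimate).
* `squareSummableInfluence_iff_groundStateForm`: the equivalence.

Consequence for the line (lead c2, NOTES/Census): the residual content of A2 is exactly "eventually, on some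
`δ₂`-window of `N`-body near-minimisers `Θ`, the `(N+1)`-body GROUND STATES are uniformly well predicted from
`Θ`"; pinning `Θ` to the `N`-body ground state as well (registered kernel `stub_groundStateInfluence`) is
what costs the nondegeneracy kernel `stub_levelUniqueWall` (shared with stmt-9072) in the registered
reduction `squareSummableInfluence_of_kernels`.
-/

noncomputable section

open MeasureTheory Filter
open scoped ENNReal NNReal Topology

namespace Summit.AtomisticToContinuum.BoseEinsteinCondensation.Theorems.SquareSummableInfluence

open Literature.MathematicalPhysics.QuantumManyBody.BoseGas
open Summit.AtomisticToContinuum.BoseEinsteinCondensation.Theorems.GroundStateRigidity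

/-! ### Uniform approximation of near-minimisers by ground states (no uniqueness) -/

/-- **Near-minimisers are uniformly close to the set of ground states.** At every `(N, L, v)` with finite
ground-state energy, for every `η > 0` there is `δ > 0` such that every trial state of energy `≤ E₀ + δ` is
within `η` in `L²` of SOME closed-form ground state (`IsGroundState`). Proof by contradiction: a sequence
of `1/(n+1)`-near-minimisers each `η`-far from every ground state has, by compactness of bounded-energy
sequences (`stub_compactness`, Rellich on the box), an `L²`-convergent subsequence whose limit is a ground
state (`IsGroundState.of_tendstoL2`) — contradiction. No nondegeneracy is assumed and no phase is needed.
[cite: ReedSimonIV1978, §XIII.12 Thm XIII.46 and Thm XIII.64] -/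
theorem nearMinimiser_near_groundState :
    ∀ (N : ℕ) (L : ℝ) (v : ℝ → ℝ≥0∞), groundStateEnergy v N L ≠ ⊤ →
      ∀ η : ℝ, 0 < η → ∃ δ : ℝ≥0∞, 0 < δ ∧ ∀ Ψ : TrialState N L,
        energy v Ψ ≤ groundStateEnergy v N L + δ →
        ∃ Ψ₀ : Config N → ℂ, IsGroundState v L Ψ₀ ∧
          ∫⁻ X, (‖Ψ.ψ X - Ψ₀ X‖₊ : ℝ≥0∞) ^ 2 ≤ ENNReal.ofReal η := by
  intro N L v hE0 η hη
  by_contra hcon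
  push Not at hcon
  -- a vanishing sequence of tolerances and, for each, a near-minimiser far from all ground states
  obtain ⟨δ, hδpos, hδle, hδ0⟩ := exists_tolerances
  choose Ψs hΨe hfar using fun n => hcon (δ n) (hδpos n)
  -- uniform energy bound `E₀ + 1 < ⊤`
  have hEtop : groundStateEnergy v N L + 1 ≠ ⊤ :=
    ENNReal.add_ne_top.2 ⟨hE0, ENNReal.one_ne_top⟩
  have hΨb : ∀ n, energy v (Ψs n) ≤ groundStateEnergy v N L + 1 := fun n =>
    (hΨe n).trans (add_le_add le_rfl (hδle n))
  -- compactness: a subsequence converging in `L²` to an admissible `f`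
  obtain ⟨f, φ, hφ, hfm, hf0, hfσ, hf⟩ := stub_compactness N L v _ Ψs hEtop hΨb
  -- the `liminf` of the energies along `φ` is `≤ E₀`
  have hup : Tendsto (fun n => groundStateEnergy v N L + δ (φ n)) atTop
      (𝓝 (groundStateEnergy v N L)) := by
    have h := (hδ0.comp hφ.tendsto_atTop).const_add (groundStateEnergy v N L)
    rw [add_zero] at h
    exact h
  have hlim : liminf (fun n => energy v (Ψs (φ n))) atTop ≤ groundStateEnergy v N L :=
    (liminf_le_liminf (Eventually.of_forall fun n => hΨe (φ n))).trans hup.liminf_eq.le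
  -- so `f` is a ground state
  have hfG : IsGroundState v L f := IsGroundState.of_tendstoL2 hfm hf0 hfσ hE0 hf hlim
  -- but `∫ |Ψ_{φ n} - f|² → 0`, contradicting `> η` for every `n`
  have hη' : (0 : ℝ≥0∞) < ENNReal.ofReal η := ENNReal.ofReal_pos.2 hη
  obtain ⟨n, hn⟩ := ((tendsto_order.1 hf).2 _ hη').exists
  exact lt_asymm hn (hfar (φ n) f hfG)

/-! ### The crux from its ground-state form -/

/-- **Ground-state form ⇒ `SquareSummableInfluence`.** If, at low density and eventually in `N`, some slack
`δ₂ > 0` makes every `δ₂`-near-minimiser `Θ` of the `N`-body energy in the `(N+1)`-box predictable from SOME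
`(N+1)`-body GROUND STATE `Ψ₀` with bounded measurable blind predictors and total squared influence `≤ ε`,
then the crux holds: for `δ > 0` replace `Ψ₀` by a `δ`-near-minimiser `Ψ` with `∫|Ψ − Ψ₀|² ≤ ε/(4(N+1))`
(`stub_groundStateApprox`) and use that the influence sum is `L²`-Lipschitz in the `(N+1)`-body state
(`stub_influenceLipschitzState`): influence `≤ 2·(ε/4) + 2N·ε/(4(N+1)) ≤ ε`.
[cite: Kato1966, VI §1.3 Thm 1.16] -/
theorem squareSummableInfluence_of_groundStateForm :
    (∀ v : ℝ → ℝ≥0∞, IsRepulsiveFiniteRange v → ∀ ε : ℝ, 0 < ε →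
      ∃ ρ₀ : ℝ, 0 < ρ₀ ∧ ∀ ρ : ℝ, 0 < ρ → ρ < ρ₀ → ∀ᶠ N : ℕ in atTop,
        ∃ δ₂ : ℝ≥0∞, 0 < δ₂ ∧ ∀ Θ : TrialState N (sideLength ρ (N + 1)),
          energy v Θ ≤ groundStateEnergy v N (sideLength ρ (N + 1)) + δ₂ →
          ∃ Ψ₀ : Config (N + 1) → ℂ, IsGroundState v (sideLength ρ (N + 1)) Ψ₀ ∧
          ∃ g : Fin N → Config (N + 1) → ℂ,
            (∀ i, Measurable (g i)) ∧ (∃ M : ℝ, ∀ i Z, ‖g i Z‖ ≤ M) ∧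
            (∀ i Z x, g i (Function.update Z (Fin.succ i) x) = g i Z) ∧
            (∑ i : Fin N, ∫⁻ Z in boxN (N + 1) (sideLength ρ (N + 1)),
                (‖Ψ₀ Z - g i Z * Θ.ψ (Matrix.vecTail Z)‖₊ : ℝ≥0∞) ^ 2) ≤ ENNReal.ofReal ε) →
    Summit.AtomisticToContinuum.BoseEinsteinCondensation.Theses.BECHeatBathGap.SquareSummableInfluence := by
  intro hGS v hv ε hε
  obtain ⟨ρ₀, hρ₀, H⟩ := hGS v hv (ε / 4) (by positivity)
  refine ⟨ρ₀, hρ₀, fun ρ hρ hρlt => ?_⟩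
  filter_upwards [H ρ hρ hρlt] with N hN
  obtain ⟨δ₂, hδ₂, hΘ⟩ := hN
  set L : ℝ := sideLength ρ (N + 1) with hL
  refine ⟨δ₂, hδ₂, fun Θ hΘe δ hδ => ?_⟩
  obtain ⟨Ψ₀, hΨ₀, g, hgm, hgb, hgu, hsum⟩ := hΘ Θ hΘe
  -- the `L²`-tolerance for the `(N+1)`-body near-minimiser
  set η : ℝ := ε / (4 * ((N : ℝ) + 1)) with hη
  have hηpos : 0 < η := by positivity
  obtain ⟨Ψ, hΨe, hΨd⟩ := stub_groundStateApprox (N + 1) L v Ψ₀ hΨ₀ δ hδ η hηpos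
  refine ⟨Ψ, hΨe, g, hgm, hgb, hgu, ?_⟩
  have hΘm : Measurable Θ.ψ := Θ.contDiff.continuous.measurable
  have hΨm : Measurable Ψ.ψ := Ψ.contDiff.continuous.measurable
  have htail : Measurable fun Z : Config (N + 1) => Matrix.vecTail Z := measurable_vecTail
  have hhm : ∀ i, Measurable fun Z : Config (N + 1) => g i Z * Θ.ψ (Matrix.vecTail Z) :=
    fun i => (hgm i).mul (hΘm.comp htail)
  have hstep := stub_influenceLipschitzState N L Ψ.ψ Ψ₀
    (fun i Z => g i Z * Θ.ψ (Matrix.vecTail Z)) hΨm hΨ₀.measurable hhm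
  -- arithmetic of the constants
  have hfin : 2 * (ε / 4) + 2 * (N : ℝ) * η ≤ ε := by
    have hB : 2 * (N : ℝ) * η = (ε / 2) * ((N : ℝ) / ((N : ℝ) + 1)) := by
      rw [hη]
      field_simp
      ring
    have hB' : (N : ℝ) / ((N : ℝ) + 1) ≤ 1 := by
      rw [div_le_one (by positivity)]
      linarith
    have h2' : (ε / 2) * ((N : ℝ) / ((N : ℝ) + 1)) ≤ ε / 2 * 1 := by gcongr
    rw [hB]
    linarith
  have hcast : (2 : ℝ≥0∞) * ENNReal.ofReal (ε / 4) + 2 * (N : ℝ≥0∞) * ENNReal.ofReal η =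
      ENNReal.ofReal (2 * (ε / 4) + 2 * (N : ℝ) * η) := by
    simp (disch := positivity) only [ENNReal.ofReal_add, ENNReal.ofReal_mul, ENNReal.ofReal_ofNat,
      ENNReal.ofReal_natCast]
  calc (∑ i : Fin N, ∫⁻ Z in boxN (N + 1) L,
        (‖Ψ.ψ Z - g i Z * Θ.ψ (Matrix.vecTail Z)‖₊ : ℝ≥0∞) ^ 2)
      ≤ 2 * (∑ i : Fin N, ∫⁻ Z in boxN (N + 1) L,
            (‖Ψ₀ Z - g i Z * Θ.ψ (Matrix.vecTail Z)‖₊ : ℝ≥0∞) ^ 2) +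
          2 * (N : ℝ≥0∞) * ∫⁻ Z, (‖Ψ.ψ Z - Ψ₀ Z‖₊ : ℝ≥0∞) ^ 2 := hstep
    _ ≤ 2 * ENNReal.ofReal (ε / 4) + 2 * (N : ℝ≥0∞) * ENNReal.ofReal η := by
        gcongr
    _ ≤ ENNReal.ofReal ε := by
        rw [hcast]
        exact ENNReal.ofReal_le_ofReal hfin

/-! ### The ground-state form from the crux -/

/-- **`SquareSummableInfluence` ⇒ ground-state form.** If the crux holds then, at low density and eventually
in `N`, some slack `δ₂ > 0` makes every `δ₂`-near-minimiser `Θ` of the `N`-body energy in the `(N+1)`-box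
predictable from SOME `(N+1)`-body GROUND STATE `Ψ₀` (bounded measurable blind predictors, total squared
influence `≤ ε`): `E₀(N+1, L') < ⊤` eventually at low density (`eventually_exists_groundStates_succBox`), so
for `η = ε/(4(N+1))` some slack `δ` puts every `δ`-near-minimiser within `η` of a ground state
(`nearMinimiser_near_groundState`); apply the crux at that slack and move the influence bound from `Ψ` to
`Ψ₀` by `stub_influenceLipschitzState`. [cite: ReedSimonIV1978, §XIII.12 Thm XIII.46 and Thm XIII.64] -/
theorem groundStateForm_of_squareSummableInfluence :
    Summit.AtomisticToContinuum.BoseEinsteinCondensation.Theses.BECHeatBathGap.SquareSummableInfluence →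
    (∀ v : ℝ → ℝ≥0∞, IsRepulsiveFiniteRange v → ∀ ε : ℝ, 0 < ε →
      ∃ ρ₀ : ℝ, 0 < ρ₀ ∧ ∀ ρ : ℝ, 0 < ρ → ρ < ρ₀ → ∀ᶠ N : ℕ in atTop,
        ∃ δ₂ : ℝ≥0∞, 0 < δ₂ ∧ ∀ Θ : TrialState N (sideLength ρ (N + 1)),
          energy v Θ ≤ groundStateEnergy v N (sideLength ρ (N + 1)) + δ₂ →
          ∃ Ψ₀ : Config (N + 1) → ℂ, IsGroundState v (sideLength ρ (N + 1)) Ψ₀ ∧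
          ∃ g : Fin N → Config (N + 1) → ℂ,
            (∀ i, Measurable (g i)) ∧ (∃ M : ℝ, ∀ i Z, ‖g i Z‖ ≤ M) ∧
            (∀ i Z x, g i (Function.update Z (Fin.succ i) x) = g i Z) ∧
            (∑ i : Fin N, ∫⁻ Z in boxN (N + 1) (sideLength ρ (N + 1)),
                (‖Ψ₀ Z - g i Z * Θ.ψ (Matrix.vecTail Z)‖₊ : ℝ≥0∞) ^ 2) ≤ ENNReal.ofReal ε) := by
  intro hcrux v hv ε hε
  obtain ⟨ρ₁, hρ₁, H1⟩ := hcrux v hv (ε / 4) (by positivity)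
  obtain ⟨ρ₂, hρ₂, H2⟩ := eventually_exists_groundStates_succBox v hv
  refine ⟨min ρ₁ ρ₂, lt_min hρ₁ hρ₂, fun ρ hρ hρlt => ?_⟩
  filter_upwards [H1 ρ hρ (hρlt.trans_le (min_le_left _ _)),
    H2 ρ hρ (hρlt.trans_le (min_le_right _ _))] with N hN1 hN2
  obtain ⟨δ₂, hδ₂, hΘ⟩ := hN1
  obtain ⟨-, ⟨Ψ₁, hΨ₁⟩⟩ := hN2
  set L : ℝ := sideLength ρ (N + 1) with hL
  have hE : groundStateEnergy v (N + 1) L ≠ ⊤ := hΨ₁.groundStateEnergy_ne_top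
  refine ⟨δ₂, hδ₂, fun Θ hΘe => ?_⟩
  -- the `L²`-tolerance and the slack at which near-minimisers are `η`-close to ground states
  set η : ℝ := ε / (4 * ((N : ℝ) + 1)) with hη
  have hηpos : 0 < η := by positivity
  obtain ⟨δ, hδ, hnear⟩ := nearMinimiser_near_groundState (N + 1) L v hE η hηpos
  obtain ⟨Ψ, hΨe, g, hgm, hgb, hgu, hsum⟩ := hΘ Θ hΘe δ hδ
  obtain ⟨Ψ₀, hΨ₀, hd⟩ := hnear Ψ hΨe
  refine ⟨Ψ₀, hΨ₀, g, hgm, hgb, hgu, ?_⟩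
  have hΘm : Measurable Θ.ψ := Θ.contDiff.continuous.measurable
  have hΨm : Measurable Ψ.ψ := Ψ.contDiff.continuous.measurable
  have htail : Measurable fun Z : Config (N + 1) => Matrix.vecTail Z := measurable_vecTail
  have hhm : ∀ i, Measurable fun Z : Config (N + 1) => g i Z * Θ.ψ (Matrix.vecTail Z) :=
    fun i => (hgm i).mul (hΘm.comp htail)
  have hstep := stub_influenceLipschitzState N L Ψ₀ Ψ.ψ
    (fun i Z => g i Z * Θ.ψ (Matrix.vecTail Z)) hΨ₀.measurable hΨm hhm
  -- `∫ |Ψ₀ - Ψ|² = ∫ |Ψ - Ψ₀|² ≤ η`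
  have hd' : ∫⁻ Z, (‖Ψ₀ Z - Ψ.ψ Z‖₊ : ℝ≥0∞) ^ 2 ≤ ENNReal.ofReal η := by
    refine le_of_eq_of_le (lintegral_congr fun Z => ?_) hd
    rw [← nnnorm_neg, neg_sub]
  -- arithmetic of the constants
  have hfin : 2 * (ε / 4) + 2 * (N : ℝ) * η ≤ ε := by
    have hB : 2 * (N : ℝ) * η = (ε / 2) * ((N : ℝ) / ((N : ℝ) + 1)) := by
      rw [hη]
      field_simp
      ring
    have hB' : (N : ℝ) / ((N : ℝ) + 1) ≤ 1 := by
      rw [div_le_one (by positivity)]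
      linarith
    have h2' : (ε / 2) * ((N : ℝ) / ((N : ℝ) + 1)) ≤ ε / 2 * 1 := by gcongr
    rw [hB]
    linarith
  have hcast : (2 : ℝ≥0∞) * ENNReal.ofReal (ε / 4) + 2 * (N : ℝ≥0∞) * ENNReal.ofReal η =
      ENNReal.ofReal (2 * (ε / 4) + 2 * (N : ℝ) * η) := by
    simp (disch := positivity) only [ENNReal.ofReal_add, ENNReal.ofReal_mul, ENNReal.ofReal_ofNat,
      ENNReal.ofReal_natCast]
  calc (∑ i : Fin N, ∫⁻ Z in boxN (N + 1) L,
        (‖Ψ₀ Z - g i Z * Θ.ψ (Matrix.vecTail Z)‖₊ : ℝ≥0∞) ^ 2)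
      ≤ 2 * (∑ i : Fin N, ∫⁻ Z in boxN (N + 1) L,
            (‖Ψ.ψ Z - g i Z * Θ.ψ (Matrix.vecTail Z)‖₊ : ℝ≥0∞) ^ 2) +
          2 * (N : ℝ≥0∞) * ∫⁻ Z, (‖Ψ₀ Z - Ψ.ψ Z‖₊ : ℝ≥0∞) ^ 2 := hstep
    _ ≤ 2 * ENNReal.ofReal (ε / 4) + 2 * (N : ℝ≥0∞) * ENNReal.ofReal η := by
        gcongr
    _ ≤ ENNReal.ofReal ε := by
        rw [hcast]
        exact ENNReal.ofReal_le_ofReal hfin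

/-- **The crux `SquareSummableInfluence` is equivalent to its ground-state form** (the `(N+1)`-body
slack layer `∀ δ > 0, ∃ δ-near-minimiser Ψ` may be replaced by `∃ ground state Ψ₀`, for every admissible
`v`, with no nondegeneracy hypothesis). [cite: ReedSimonIV1978, §XIII.12 Thm XIII.46 and Thm XIII.64] -/
theorem squareSummableInfluence_iff_groundStateForm :
    Summit.AtomisticToContinuum.BoseEinsteinCondensation.Theses.BECHeatBathGap.SquareSummableInfluence ↔
    (∀ v : ℝ → ℝ≥0∞, IsRepulsiveFiniteRange v → ∀ ε : ℝ, 0 < ε →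
      ∃ ρ₀ : ℝ, 0 < ρ₀ ∧ ∀ ρ : ℝ, 0 < ρ → ρ < ρ₀ → ∀ᶠ N : ℕ in atTop,
        ∃ δ₂ : ℝ≥0∞, 0 < δ₂ ∧ ∀ Θ : TrialState N (sideLength ρ (N + 1)),
          energy v Θ ≤ groundStateEnergy v N (sideLength ρ (N + 1)) + δ₂ →
          ∃ Ψ₀ : Config (N + 1) → ℂ, IsGroundState v (sideLength ρ (N + 1)) Ψ₀ ∧
          ∃ g : Fin N → Config (N + 1) → ℂ,
            (∀ i, Measurable (g i)) ∧ (∃ M : ℝ, ∀ i Z, ‖g i Z‖ ≤ M) ∧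
            (∀ i Z x, g i (Function.update Z (Fin.succ i) x) = g i Z) ∧
            (∑ i : Fin N, ∫⁻ Z in boxN (N + 1) (sideLength ρ (N + 1)),
                (‖Ψ₀ Z - g i Z * Θ.ψ (Matrix.vecTail Z)‖₊ : ℝ≥0∞) ^ 2) ≤ ENNReal.ofReal ε) :=
  ⟨groundStateForm_of_squareSummableInfluence, squareSummableInfluence_of_groundStateForm⟩

end Summit.AtomisticToContinuum.BoseEinsteinCondensation.Theorems.SquareSummableInfluence

end
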